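import Summits.PneNP.PneNP.Theorems.ConstantBand.Negative.LoadBearing
import Summits.PneNP.PneNP.Theorems.SingleThreshold.Negative.LoadBearing
import Summits.PneNP.PneNP.Theorems.SliceACZero.Negative.WindowDepth
import Literature.Computability.Complexity.CliqueThresholdBounds

/-!
# Crux `SliceTarget` (stmt-PneNP-2832), line `Sketch-ideator3-r1`: stub B3 `PairBound` — auxiliary counting I

Generic finite counting behind the pair bound `Σ_Φ a_Φ²/#Φ ≤ (λ² + λ·|F|/N + ε)·#slice_j` (stub `stub_pairBound`,
file `OneSliceSliceTargetPairBound.lean`). With `N = C(n,2)`, `U = Fᶜ` the unread slots (`M = #U ≥ N/2`), `q = j/N`: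

* `pb_choose_sub_mul_pow_le` — `C(M, t-s)·(M+1-t)^s ≤ C(M,t)·t^s` (ratio of neighbouring binomial coefficients);
* `pb_sum_pow_card_union_le` — for a fixed set `D` and `0 < q ≤ 1`,
  `Σ_{T ⊆ U, #T = t} q^{#(D ∪ T)} ≤ C(M,t)·q^{#D+t}·(1 + 2^{#D}·t·(t/((M+1-t)q)))` (group `T` by `#(D ∩ T)`);
* `pb_card_slice_supset_le` — hypergeometric tail `#{x ∈ slice_j : E ⊆ x} ≤ q^{#E}·#slice_j`;
* `pb_sum_choose_div_le` — the DOUBLE COUNT behind the replica term: for `#D ≤ 2K`, `t ≤ K`, `4K ≤ j ≤ N`, `4K ≤ N`,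
  `2·#F ≤ N`: `Σ_{x ∈ slice_j, D ⊆ x} C(#(x ∖ F), t)/C(M, t) ≤ (1 + 4^{K+1}K²/j)·q^{#D+t}·#slice_j`
  (`C(#(x ∖ F), t)` counts the `t`-subsets `T ⊆ U` inside `x`; swap the sums and use the two items above);
* `pb_card_filter_cliqueEdges_subset_mul_le` — few `k`-sets have ALL their clique edges read:
  `N·#{A : K_A ⊆ F} ≤ #F·C(n,k)` (double counting `Σ_A #(K_A ∩ U) = M·C(n-2,k-2)` and `N·C(n-2,k-2) = C(k,2)·C(n,k)`);
* `pb_card_cliqueEdges_union_add`, `pb_card_inter_lt_of_ne`, `pb_card_filter_card_inter_eq_le` — clique edge sets of two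
  `k`-sets (`#(K_A ∪ K_B) = 2C(k,2) - C(#(A ∩ B),2)`; the `B` with `#(A ∩ B) = i` are `≤ C(k,i)·C(n,k-i)`), re-derived from
  the sibling stub-T5 file `OneSliceSliceTargetCoincidenceTail2.lean` (private there).

All statements are finite and exact; no asymptotics here. Worker file for the line lead prover-line-stmt-PneNP-2832-0,
2026-08-16.
-/

set_option linter.dupNamespace false

namespace Summit.PneNP.PneNP.Cruxes.SliceTarget.Ideator3Line

open Literature.Computability.Complexity Finset Filter Classical
open scoped Topology
open Summit.PneNP.PneNP.Theorems.ConstantBand.Negative (Edge thr Central slice)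
open Summit.PneNP.PneNP.Theorems.SliceACZero.Negative (sliceCard sliceCard_eq card_slice_supset_le
  choose_sub_mul_pow_le_choose_mul_pow)

noncomputable section

/-! ## Ratios of binomial coefficients -/

/-- **Neighbouring binomial coefficients**: `C(M, t-s)·(M+1-t)^s ≤ C(M, t)·t^s` for `s ≤ t ≤ M`
(iterate `C(M, a+1)·(a+1) = C(M, a)·(M-a)` with `a + 1 ≤ t`, `M - a ≥ M + 1 - t`). [folklore] -/
theorem pb_choose_sub_mul_pow_le {M t : ℕ} (htM : t ≤ M) (s : ℕ) (hs : s ≤ t) :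
    M.choose (t - s) * (M + 1 - t) ^ s ≤ M.choose t * t ^ s := by
  induction s with
  | zero => simp
  | succ s ih =>
    have key : M.choose (t - (s + 1)) * (M + 1 - t) ≤ M.choose (t - s) * t := by
      have h := Nat.choose_succ_right_eq M (t - (s + 1))
      have h1 : t - (s + 1) + 1 = t - s := by omega
      rw [h1] at h
      calc M.choose (t - (s + 1)) * (M + 1 - t) ≤ M.choose (t - (s + 1)) * (M - (t - (s + 1))) :=
            Nat.mul_le_mul_left _ (by omega)
        _ = M.choose (t - s) * (t - s) := h.symm
        _ ≤ M.choose (t - s) * t := Nat.mul_le_mul_left _ (Nat.sub_le _ _)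
    calc M.choose (t - (s + 1)) * (M + 1 - t) ^ (s + 1)
        = M.choose (t - (s + 1)) * (M + 1 - t) * (M + 1 - t) ^ s := by ring
      _ ≤ M.choose (t - s) * t * (M + 1 - t) ^ s := Nat.mul_le_mul_right _ key
      _ = t * (M.choose (t - s) * (M + 1 - t) ^ s) := by ring
      _ ≤ t * (M.choose t * t ^ s) := Nat.mul_le_mul_left _ (ih (by omega))
      _ = M.choose t * t ^ (s + 1) := by ring

/-- The `t`-subsets `T ⊆ U` meeting a fixed `D` in exactly `s` elements number at most `2^{#D}·C(#U, t-s)`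
(`T ↦ (D ∩ T, T ∖ D)` is injective). [folklore] -/
theorem pb_card_filter_card_inter_le {α : Type*} [DecidableEq α] (U D : Finset α) (t s : ℕ) :
    #((powersetCard t U).filter fun T => #(D ∩ T) = s) ≤ 2 ^ #D * (#U).choose (t - s) := by
  calc #((powersetCard t U).filter fun T => #(D ∩ T) = s) ≤ #(D.powerset ×ˢ powersetCard (t - s) U) := by
        refine card_le_card_of_injOn (fun T => (D ∩ T, T \ D)) (fun T hT => ?_) (fun T₁ _ T₂ _ h => ?_)
        · rw [mem_coe, mem_filter, mem_powersetCard] at hT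
          obtain ⟨⟨hTU, hTt⟩, hs⟩ := hT
          simp only [mem_coe, mem_product, mem_powerset, mem_powersetCard]
          refine ⟨inter_subset_left, sdiff_subset.trans hTU, ?_⟩
          have := card_sdiff_add_card_inter T D
          rw [inter_comm] at hs
          omega
        · simp only [Prod.mk.injEq] at h
          ext v
          by_cases hv : v ∈ D
          · simpa [hv] using congrArg (v ∈ ·) h.1
          · simpa [hv] using congrArg (v ∈ ·) h.2
    _ = 2 ^ #D * (#U).choose (t - s) := by rw [card_product, card_powerset, card_powersetCard]

/-- **Union exponents over a uniform layer.** For a fixed set `D`, `0 < q ≤ 1`, `t ≤ M = #U` and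
`t ≤ (M+1-t)·q`: `Σ_{T ⊆ U, #T = t} q^{#(D ∪ T)} ≤ C(M,t)·q^{#D+t}·(1 + 2^{#D}·t·(t/((M+1-t)·q)))` — the `T`
disjoint from `D` contribute `q^{#D+t}` each, those with `#(D ∩ T) = s ≥ 1` are `≤ 2^{#D} C(M,t-s) ≤ 2^{#D} C(M,t)(t/(M+1-t))^s`
in number and contribute `q^{#D+t-s}` each. [folklore] -/
theorem pb_sum_pow_card_union_le {α : Type*} [DecidableEq α] (U D : Finset α) {t : ℕ} (ht : t ≤ #U)
    {q : ℝ} (hq0 : 0 < q) (hy : (t : ℝ) ≤ ((#U : ℝ) + 1 - t) * q) :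
    ∑ T ∈ powersetCard t U, q ^ #(D ∪ T) ≤
      ((#U).choose t : ℝ) * q ^ (#D + t) * (1 + 2 ^ #D * t * ((t : ℝ) / (((#U : ℝ) + 1 - t) * q))) := by
  set M := #U with hM
  set y : ℝ := (t : ℝ) / (((M : ℝ) + 1 - t) * q) with hy_def
  have hMt : (0 : ℝ) < (M : ℝ) + 1 - t := by
    have : (t : ℝ) ≤ M := by exact_mod_cast ht
    linarith
  have hden : (0 : ℝ) < ((M : ℝ) + 1 - t) * q := mul_pos hMt hq0
  have hy0 : 0 ≤ y := div_nonneg (Nat.cast_nonneg _) hden.le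
  have hy1 : y ≤ 1 := (div_le_one hden).2 hy
  -- group the `T` by `s = #(D ∩ T)`
  have hmaps : ∀ T ∈ powersetCard t U, #(D ∩ T) ∈ range (t + 1) := by
    intro T hT
    rw [mem_range, Nat.lt_succ_iff, ← (mem_powersetCard.1 hT).2]
    exact card_le_card inter_subset_right
  rw [← sum_fiberwise_of_maps_to hmaps]
  have hfib : ∀ s ∈ range (t + 1),
      ∑ T ∈ (powersetCard t U).filter (fun T => #(D ∩ T) = s), q ^ #(D ∪ T) =
        #((powersetCard t U).filter fun T => #(D ∩ T) = s) * q ^ (#D + t - s) := by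
    intro s _
    rw [← nsmul_eq_mul, ← sum_const]
    refine sum_congr rfl fun T hT => ?_
    obtain ⟨hT, hs⟩ := mem_filter.1 hT
    have h := card_union_add_card_inter D T
    rw [(mem_powersetCard.1 hT).2, hs] at h
    rw [show #(D ∪ T) = #D + t - s by omega]
  rw [sum_congr rfl hfib, sum_range_succ']
  -- the `T` disjoint from `D`
  have h0 : (#((powersetCard t U).filter fun T => #(D ∩ T) = 0) : ℝ) * q ^ (#D + t - 0) ≤
      (M.choose t : ℝ) * q ^ (#D + t) := by
    rw [Nat.sub_zero]
    refine mul_le_mul_of_nonneg_right ?_ (pow_nonneg hq0.le _)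
    have h := card_le_card (filter_subset (fun T => #(D ∩ T) = 0) (powersetCard t U))
    rw [card_powersetCard] at h
    exact_mod_cast h
  -- the `T` meeting `D` in `s + 1` elements
  have h1 : ∀ s ∈ range t, (#((powersetCard t U).filter fun T => #(D ∩ T) = s + 1) : ℝ) * q ^ (#D + t - (s + 1)) ≤
      (M.choose t : ℝ) * q ^ (#D + t) * (2 ^ #D * y) := by
    intro s hs
    rw [mem_range] at hs
    have hcount : (#((powersetCard t U).filter fun T => #(D ∩ T) = s + 1) : ℝ) ≤ 2 ^ #D * (M.choose (t - (s + 1)) : ℝ) := by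
      exact_mod_cast pb_card_filter_card_inter_le U D t (s + 1)
    have hratio : (M.choose (t - (s + 1)) : ℝ) * ((M : ℝ) + 1 - t) ^ (s + 1) ≤ (M.choose t : ℝ) * (t : ℝ) ^ (s + 1) := by
      have h := pb_choose_sub_mul_pow_le ht (s + 1) (by omega)
      have hc : (((M + 1 - t : ℕ) : ℝ)) = (M : ℝ) + 1 - t := by
        rw [Nat.cast_sub (by omega), Nat.cast_add, Nat.cast_one]
      rw [← hc]
      exact_mod_cast h
    have hqpow : q ^ (#D + t - (s + 1)) = q ^ (#D + t) / q ^ (s + 1) := by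
      rw [eq_div_iff (pow_pos hq0 _).ne', ← pow_add, Nat.sub_add_cancel (by omega)]
    have hys : y ^ (s + 1) ≤ y := pow_le_of_le_one hy0 hy1 (Nat.succ_ne_zero s)
    have hpow0 : (0 : ℝ) < ((M : ℝ) + 1 - t) ^ (s + 1) := pow_pos hMt _
    calc (#((powersetCard t U).filter fun T => #(D ∩ T) = s + 1) : ℝ) * q ^ (#D + t - (s + 1))
        ≤ 2 ^ #D * (M.choose (t - (s + 1)) : ℝ) * (q ^ (#D + t) / q ^ (s + 1)) := by
          rw [hqpow]; exact mul_le_mul_of_nonneg_right hcount (by positivity)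
      _ ≤ 2 ^ #D * ((M.choose t : ℝ) * (t : ℝ) ^ (s + 1) / ((M : ℝ) + 1 - t) ^ (s + 1)) * (q ^ (#D + t) / q ^ (s + 1)) := by
          gcongr
          rw [le_div_iff₀ hpow0]
          exact hratio
      _ = (M.choose t : ℝ) * q ^ (#D + t) * (2 ^ #D * y ^ (s + 1)) := by
          rw [hy_def, div_pow, mul_pow]
          field_simp
      _ ≤ (M.choose t : ℝ) * q ^ (#D + t) * (2 ^ #D * y) := by gcongr
  calc ∑ s ∈ range t, (#((powersetCard t U).filter fun T => #(D ∩ T) = s + 1) : ℝ) * q ^ (#D + t - (s + 1)) +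
        (#((powersetCard t U).filter fun T => #(D ∩ T) = 0) : ℝ) * q ^ (#D + t - 0)
      ≤ ∑ _s ∈ range t, (M.choose t : ℝ) * q ^ (#D + t) * (2 ^ #D * y) + (M.choose t : ℝ) * q ^ (#D + t) :=
        add_le_add (sum_le_sum h1) h0
    _ = (M.choose t : ℝ) * q ^ (#D + t) * (1 + 2 ^ #D * t * y) := by
        rw [sum_const, card_range, nsmul_eq_mul]; ring

/-! ## Slice counts -/

/-- **Hypergeometric tail on a slice**: for `j ≤ N = C(n,2)`, `0 < N` and a fixed edge set `E`,
`#{x ∈ slice_j : E ⊆ x} ≤ (j/N)^{#E}·#slice_j`. [folklore] -/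
theorem pb_card_slice_supset_le {n j : ℕ} (E : Finset (Edge n)) (hjN : j ≤ n.choose 2) (hN : 0 < n.choose 2) :
    (#((slice n j).filter fun x => ∀ e ∈ E, x e = true) : ℝ) ≤ ((j : ℝ) / (n.choose 2 : ℕ)) ^ #E * #(slice n j) := by
  -- adapted from Theorems/OneSliceSliceTargetCoincidenceTail2.lean (`card_slice_filter_supset_mul_le`)
  have hslice : #(slice n j) = (n.choose 2).choose j := sliceCard_eq n j
  have hNr : (0 : ℝ) < (n.choose 2 : ℕ) := by exact_mod_cast hN
  rw [div_pow, div_mul_eq_mul_div, le_div_iff₀ (pow_pos hNr _)]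
  by_cases hE : #E ≤ j
  · have h1 : #((slice n j).filter fun x => ∀ e ∈ E, x e = true) ≤ (n.choose 2 - #E).choose (j - #E) := by
      have h := card_slice_supset_le j E hE
      rwa [← filter_filter] at h
    have h2 := choose_sub_mul_pow_le_choose_mul_pow hE hjN
    calc (#((slice n j).filter fun x => ∀ e ∈ E, x e = true) : ℝ) * ((n.choose 2 : ℕ) : ℝ) ^ #E
        ≤ (((n.choose 2 - #E).choose (j - #E) : ℕ) : ℝ) * ((n.choose 2 : ℕ) : ℝ) ^ #E := by
          exact mul_le_mul_of_nonneg_right (by exact_mod_cast h1) (by positivity)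
      _ ≤ (((n.choose 2).choose j : ℕ) : ℝ) * (j : ℝ) ^ #E := by exact_mod_cast h2
      _ = (j : ℝ) ^ #E * #(slice n j) := by rw [hslice, mul_comm]
  · have h0 : (slice n j).filter (fun x => ∀ e ∈ E, x e = true) = ∅ := by
      refine filter_eq_empty_iff.2 fun x hx hall => hE ?_
      rw [← (mem_filter.1 hx).2, edgeCount]
      exact card_le_card fun e he => mem_filter.2 ⟨mem_univ _, hall e he⟩
    rw [h0, card_empty, Nat.cast_zero, zero_mul]
    positivity

/-- **The double count behind the replica term.** For `D` with `#D ≤ 2K`, `t ≤ K`, `4K ≤ j ≤ N = C(n,2)`, `4K ≤ N`,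
`1 ≤ K` and a read set `F` with `2·#F ≤ N` (`U = Fᶜ`, `M = #U`):
`Σ_{x ∈ slice_j, D ⊆ x} C(#(x ∖ F), t)/C(M, t) ≤ (1 + 4^{K+1}K²/j)·(j/N)^{#D+t}·#slice_j`. Indeed `C(#(x ∖ F), t)`
counts the `t`-sets `T ⊆ U` inside `x`, so the left side is `Σ_{T ⊆ U, #T=t} #{x ∈ slice_j : D ∪ T ⊆ x}/C(M,t)
≤ Σ_T q^{#(D ∪ T)}·#slice_j/C(M,t)` (`pb_card_slice_supset_le`), and `pb_sum_pow_card_union_le` applies with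
`(M+1-t)q ≥ j/4 ≥ K`. [folklore] -/
theorem pb_sum_choose_div_le {n j K t : ℕ} (F D : Finset (Edge n)) (htK : t ≤ K) (hD : #D ≤ 2 * K) (hK : 1 ≤ K)
    (hKN : 4 * K ≤ n.choose 2) (hKj : 4 * K ≤ j) (hjN : j ≤ n.choose 2) (h2F : 2 * #F ≤ n.choose 2) :
    ∑ x ∈ (slice n j).filter (fun x => ∀ e ∈ D, x e = true),
        (((#(onSet x \ F)).choose t : ℕ) : ℝ) / ((#Fᶜ).choose t : ℕ) ≤
      (1 + 4 ^ (K + 1) * (K : ℝ) ^ 2 / j) * ((j : ℝ) / (n.choose 2 : ℕ)) ^ (#D + t) * #(slice n j) := by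
  set N := n.choose 2 with hNdef
  set M := #Fᶜ with hM
  set q : ℝ := (j : ℝ) / (N : ℕ) with hq
  set X := (slice n j).filter (fun x => ∀ e ∈ D, x e = true) with hX
  have hMval : M = N - #F := by rw [hM, card_compl, card_edgeSet_top_fin]
  have hN : 0 < N := by omega
  have hNr : (0 : ℝ) < (N : ℕ) := by exact_mod_cast hN
  have hj0 : (0 : ℝ) < j := by exact_mod_cast (show 0 < j by omega)
  have hq0 : 0 < q := div_pos hj0 hNr
  have htM : t ≤ M := by omega
  have hS0 : (0 : ℝ) ≤ #(slice n j) := Nat.cast_nonneg _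
  -- Step 1: `C(#(x ∖ F), t) = #{T ⊆ U : #T = t, T ⊆ x}` and the swap of sums
  have key : ∀ x ∈ X, (#(onSet x \ F)).choose t = #((powersetCard t Fᶜ).filter fun T => ∀ e ∈ T, x e = true) := by
    intro x _
    rw [← card_powersetCard]
    congr 1
    ext T
    rw [mem_powersetCard, mem_filter, mem_powersetCard]
    constructor
    · rintro ⟨h1, h2⟩
      exact ⟨⟨fun e he => mem_compl.2 (mem_sdiff.1 (h1 he)).2, h2⟩,
        fun e he => (mem_onSet x e).1 (mem_sdiff.1 (h1 he)).1⟩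
    · rintro ⟨⟨h1, h2⟩, h3⟩
      exact ⟨fun e he => mem_sdiff.2 ⟨(mem_onSet x e).2 (h3 e he), mem_compl.1 (h1 he)⟩, h2⟩
  have hswap := sum_card_bipartiteAbove_eq_sum_card_bipartiteBelow
    (fun (x : Edge n → Bool) (T : Finset (Edge n)) => ∀ e ∈ T, x e = true) (s := X) (t := powersetCard t Fᶜ)
  simp only [bipartiteAbove, bipartiteBelow] at hswap
  have hdc : ∑ x ∈ X, (((#(onSet x \ F)).choose t : ℕ) : ℝ) =
      ∑ T ∈ powersetCard t Fᶜ, (#(X.filter fun x => ∀ e ∈ T, x e = true) : ℝ) := by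
    have h : ∑ x ∈ X, (#(onSet x \ F)).choose t = ∑ T ∈ powersetCard t Fᶜ, #(X.filter fun x => ∀ e ∈ T, x e = true) := by
      rw [sum_congr rfl key]; exact hswap
    exact_mod_cast congrArg (Nat.cast (R := ℝ)) h
  -- Step 2: each inner count is a slice count
  have hT : ∀ T ∈ powersetCard t Fᶜ, (#(X.filter fun x => ∀ e ∈ T, x e = true) : ℝ) ≤ q ^ #(D ∪ T) * #(slice n j) := by
    intro T _
    have heq : X.filter (fun x => ∀ e ∈ T, x e = true) = (slice n j).filter (fun x => ∀ e ∈ D ∪ T, x e = true) := by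
      rw [hX, filter_filter]
      refine filter_congr fun x _ => ?_
      simp only [mem_union]
      exact ⟨fun h e he => he.elim (h.1 e) (h.2 e), fun h => ⟨fun e he => h e (Or.inl he), fun e he => h e (Or.inr he)⟩⟩
    rw [heq]
    exact pb_card_slice_supset_le (D ∪ T) hjN hN
  -- Step 3: the layer sum
  have hMhalf : (N : ℝ) ≤ 4 * ((M : ℝ) + 1 - t) := by
    have h : N ≤ 4 * (M + 1 - t) := by omega
    have h' : ((4 * (M + 1 - t) : ℕ) : ℝ) = 4 * ((M : ℝ) + 1 - t) := by
      rw [Nat.cast_mul, Nat.cast_sub (by omega)]; push_cast; ring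
    rw [← h']; exact_mod_cast h
  have hden : (j : ℝ) / 4 ≤ ((M : ℝ) + 1 - t) * q := by
    calc (j : ℝ) / 4 = ((N : ℕ) : ℝ) / 4 * ((j : ℝ) / (N : ℕ)) := by field_simp
      _ ≤ ((M : ℝ) + 1 - t) * q := by
          rw [hq]
          exact mul_le_mul_of_nonneg_right (by linarith) (div_nonneg hj0.le hNr.le)
  have hKr : (1 : ℝ) ≤ K := by exact_mod_cast hK
  have htr : (t : ℝ) ≤ K := by exact_mod_cast htK
  have hjK : 4 * (K : ℝ) ≤ j := by exact_mod_cast hKj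
  have hy : (t : ℝ) ≤ ((M : ℝ) + 1 - t) * q := by linarith
  have hlayer := pb_sum_pow_card_union_le Fᶜ D htM hq0 hy
  have hθ : 2 ^ #D * t * ((t : ℝ) / (((M : ℝ) + 1 - t) * q)) ≤ 4 ^ (K + 1) * (K : ℝ) ^ 2 / j := by
    have hd0 : (0 : ℝ) < ((M : ℝ) + 1 - t) * q := by linarith
    have h1 : (t : ℝ) / (((M : ℝ) + 1 - t) * q) ≤ 4 * K / j := by
      rw [div_le_div_iff₀ hd0 hj0]; nlinarith
    have h2 : (2 : ℝ) ^ #D ≤ 4 ^ K := by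
      calc (2 : ℝ) ^ #D ≤ 2 ^ (2 * K) := pow_le_pow_right₀ (by norm_num) hD
        _ = 4 ^ K := by rw [pow_mul]; norm_num
    calc 2 ^ #D * t * ((t : ℝ) / (((M : ℝ) + 1 - t) * q)) ≤ 4 ^ K * K * (4 * K / j) := by
          gcongr
      _ = 4 ^ (K + 1) * (K : ℝ) ^ 2 / j := by rw [pow_succ]; ring
  have hMc : (0 : ℝ) < (M.choose t : ℕ) := by exact_mod_cast Nat.choose_pos htM
  -- assemble
  rw [← sum_div, hdc, div_le_iff₀ hMc]
  calc ∑ T ∈ powersetCard t Fᶜ, (#(X.filter fun x => ∀ e ∈ T, x e = true) : ℝ)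
      ≤ ∑ T ∈ powersetCard t Fᶜ, q ^ #(D ∪ T) * #(slice n j) := sum_le_sum hT
    _ = (∑ T ∈ powersetCard t Fᶜ, q ^ #(D ∪ T)) * #(slice n j) := by rw [sum_mul]
    _ ≤ ((M.choose t : ℝ) * q ^ (#D + t) * (1 + 2 ^ #D * t * ((t : ℝ) / (((M : ℝ) + 1 - t) * q)))) * #(slice n j) :=
        mul_le_mul_of_nonneg_right hlayer hS0
    _ ≤ ((M.choose t : ℝ) * q ^ (#D + t) * (1 + 4 ^ (K + 1) * (K : ℝ) ^ 2 / j)) * #(slice n j) := by gcongr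
    _ = (1 + 4 ^ (K + 1) * (K : ℝ) ^ 2 / j) * q ^ (#D + t) * #(slice n j) * (M.choose t : ℕ) := by ring

/-- **The double count behind the replica term, registered form** (helper of stub B3 `stub_pairBound`; closed statement
`pb_sum_choose_div_le`): `Σ_{x ∈ slice_j, D ⊆ x} C(#(x ∖ F), t)/C(#Fᶜ, t) ≤ (1 + 4^{K+1}K²/j)·(j/N)^{#D+t}·#slice_j` for
`t ≤ K`, `#D ≤ 2K`, `1 ≤ K`, `4K ≤ N`, `4K ≤ j ≤ N`, `2·#F ≤ N`. [folklore] -/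
theorem pb_pairTermCount :
    ∀ (n j K t : ℕ) (F D : Finset (Edge n)), t ≤ K → #D ≤ 2 * K → 1 ≤ K → 4 * K ≤ n.choose 2 → 4 * K ≤ j →
      j ≤ n.choose 2 → 2 * #F ≤ n.choose 2 →
        ∑ x ∈ (slice n j).filter (fun x => ∀ e ∈ D, x e = true),
            (((#(onSet x \ F)).choose t : ℕ) : ℝ) / ((#Fᶜ).choose t : ℕ) ≤
          (1 + 4 ^ (K + 1) * (K : ℝ) ^ 2 / j) * ((j : ℝ) / (n.choose 2 : ℕ)) ^ (#D + t) * #(slice n j) :=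
  fun _ _ _ _ F D htK hD hK hKN hKj hjN h2F => pb_sum_choose_div_le F D htK hD hK hKN hKj hjN h2F

/-! ## Few `k`-sets have all their clique edges read -/

/-- **Few `k`-sets have all their clique edges in `F`**: for `2 ≤ k` and `#F ≤ N = C(n,2)`,
`N · #{A : K_A ⊆ F} ≤ #F · C(n,k)`. Double counting: `Σ_A #(K_A ∖ F) = Σ_{e ∉ F} #{A ∋ both ends of e} = (N - #F)·C(n-2,k-2)`,
each `#(K_A ∖ F) ≤ C(k,2)` and vanishes when `K_A ⊆ F`, and `N·C(n-2,k-2) = C(k,2)·C(n,k)`. [folklore] -/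
theorem pb_card_filter_cliqueEdges_subset_mul_le {n k : ℕ} (hk : 2 ≤ k) (F : Finset (Edge n)) (hF : #F ≤ n.choose 2) :
    n.choose 2 * #((powersetCard k (univ : Finset (Fin n))).filter fun A =>
        #((univ.filter fun e : Edge n => cliqueVec A e = true) \ F) = 0) ≤ #F * n.choose k := by
  set 𝒜 := powersetCard k (univ : Finset (Fin n)) with h𝒜
  set S : Finset (Fin n) → Finset (Edge n) := fun A => univ.filter fun e : Edge n => cliqueVec A e = true with hS
  set N := n.choose 2 with hN
  set K := k.choose 2 with hK
  have hcard𝒜 : #𝒜 = n.choose k := by rw [h𝒜, card_powersetCard, card_univ, Fintype.card_fin]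
  have hSA : ∀ A ∈ 𝒜, #(S A) = K := fun A hA => by rw [hS, hK]; simp only; rw [card_filter_cliqueVec, (mem_powersetCard.1 hA).2]
  -- double counting `Σ_A #(S A ∖ F) = Σ_{e ∈ Fᶜ} #{A : e ∈ S A} = #Fᶜ · C(n-2, k-2)`
  have hswap := sum_card_bipartiteAbove_eq_sum_card_bipartiteBelow
    (fun (A : Finset (Fin n)) (e : Edge n) => cliqueVec A e = true) (s := 𝒜) (t := Fᶜ)
  simp only [bipartiteAbove, bipartiteBelow] at hswap
  have hleft : ∀ A ∈ 𝒜, #(Fᶜ.filter fun e => cliqueVec A e = true) = #(S A \ F) := by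
    intro A _
    congr 1; ext e; simp [hS, and_comm]
  have hright : ∀ e ∈ Fᶜ, #(𝒜.filter fun A => cliqueVec A e = true) = (n - 2).choose (k - 2) := by
    intro e _
    have h := card_filter_powersetCard_subset (endpts e) (univ : Finset (Fin n)) k (subset_univ _)
      (by rw [card_endpts]; exact hk)
    rw [card_univ, Fintype.card_fin, card_endpts] at h
    rw [← h, h𝒜]
    congr 1
    exact filter_congr fun A _ => cliqueVec_eq_true_iff_endpts A e
  have hsum : ∑ A ∈ 𝒜, #(S A \ F) = #Fᶜ * (n - 2).choose (k - 2) := by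
    rw [← sum_congr rfl hleft, hswap, sum_congr rfl hright, sum_const, smul_eq_mul]
  -- `Σ_A #(S A ∖ F) ≤ K · #{A : #(S A ∖ F) ≠ 0}`
  have hup : ∑ A ∈ 𝒜, #(S A \ F) ≤ K * #(𝒜.filter fun A => ¬ #(S A \ F) = 0) := by
    rw [← sum_filter_add_sum_filter_not 𝒜 (fun A => #(S A \ F) = 0), sum_congr rfl fun A hA => (mem_filter.1 hA).2,
      sum_const_zero, zero_add, mul_comm]
    calc ∑ A ∈ 𝒜.filter (fun A => ¬ #(S A \ F) = 0), #(S A \ F) ≤ ∑ _A ∈ 𝒜.filter (fun A => ¬ #(S A \ F) = 0), K :=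
          sum_le_sum fun A hA => (card_le_card sdiff_subset).trans (hSA A (mem_filter.1 hA).1).le
      _ = #(𝒜.filter fun A => ¬ #(S A \ F) = 0) * K := by rw [sum_const, smul_eq_mul]
  have hNK : n.choose k * K = N * (n - 2).choose (k - 2) := Nat.choose_mul hk
  have hsplit := card_filter_add_card_filter_not (s := 𝒜) (fun A => #(S A \ F) = 0)
  have hM : #Fᶜ = N - #F := by rw [card_compl, card_edgeSet_top_fin]
  have hKpos : 0 < K := Nat.choose_pos hk
  -- `N · K · #{≠ 0} ≥ N · Σ = N · M · C(n-2,k-2) = M · K · C(n,k)`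
  have h1 : (N - #F) * (n.choose k * K) ≤ N * (K * #(𝒜.filter fun A => ¬ #(S A \ F) = 0)) := by
    rw [hNK, show (N - #F) * (N * (n - 2).choose (k - 2)) = N * (#Fᶜ * (n - 2).choose (k - 2)) by rw [hM]; ring, ← hsum]
    exact Nat.mul_le_mul_left _ hup
  have h2 : (N - #F) * n.choose k ≤ N * #(𝒜.filter fun A => ¬ #(S A \ F) = 0) := by
    have : (N - #F) * n.choose k * K ≤ N * #(𝒜.filter fun A => ¬ #(S A \ F) = 0) * K := by
      calc (N - #F) * n.choose k * K = (N - #F) * (n.choose k * K) := by ring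
        _ ≤ N * (K * #(𝒜.filter fun A => ¬ #(S A \ F) = 0)) := h1
        _ = N * #(𝒜.filter fun A => ¬ #(S A \ F) = 0) * K := by ring
    exact Nat.le_of_mul_le_mul_right this hKpos
  rw [hcard𝒜] at hsplit
  have h3 : N * #(𝒜.filter fun A => #(S A \ F) = 0) + N * #(𝒜.filter fun A => ¬ #(S A \ F) = 0) =
      (#F + (N - #F)) * n.choose k := by rw [← mul_add, hsplit, Nat.add_sub_cancel' hF]
  nlinarith [h2, h3]

/-! ## Clique edge sets: unions and overlaps -/

/-- `#(K_A ∪ K_B) + C(#(A ∩ B),2) = C(#A,2) + C(#B,2)` (`K_A ∩ K_B = K_{A ∩ B}`). [folklore] -/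
theorem pb_card_cliqueEdges_union_add {n : ℕ} (A B : Finset (Fin n)) :
    #((univ.filter fun e : Edge n => cliqueVec A e = true) ∪ (univ.filter fun e : Edge n => cliqueVec B e = true)) +
        (#(A ∩ B)).choose 2 = (#A).choose 2 + (#B).choose 2 := by
  -- adapted from Theorems/OneSliceSliceTargetCoincidenceTail2.lean (`card_cliqueEdges_union_add`)
  have hinter : (univ.filter fun e : Edge n => cliqueVec A e = true) ∩ (univ.filter fun e : Edge n => cliqueVec B e = true) =
      univ.filter fun e : Edge n => cliqueVec (A ∩ B) e = true := by
    rw [← filter_and]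
    refine filter_congr fun e _ => ?_
    rw [cliqueVec_inter, Bool.and_eq_true]
    tauto
  rw [← card_filter_cliqueVec A, ← card_filter_cliqueVec B, ← card_filter_cliqueVec (A ∩ B), ← hinter]
  exact card_union_add_card_inter _ _

/-- Two distinct `k`-sets meet in fewer than `k` vertices. [folklore] -/
theorem pb_card_inter_lt_of_ne {n k : ℕ} {A B : Finset (Fin n)} (hA : A ∈ powersetCard k (univ : Finset (Fin n)))
    (hB : B ∈ powersetCard k (univ : Finset (Fin n))) (hne : A ≠ B) : #(A ∩ B) < k := by
  -- adapted from Theorems/OneSliceSliceTargetCoincidenceTail2.lean (`card_inter_lt_of_ne`)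
  have hAk := (mem_powersetCard.1 hA).2
  have hBk := (mem_powersetCard.1 hB).2
  by_contra hlt
  have h1 : A ∩ B = A := eq_of_subset_of_card_le inter_subset_left (by omega)
  exact hne (eq_of_subset_of_card_le (h1 ▸ inter_subset_right) (by omega))

/-- The `k`-sets meeting a fixed `k`-set `A` in exactly `i` vertices number at most `C(k,i)·C(n,k-i)`
(`B ↦ (A ∩ B, B ∖ A)` is injective). [folklore] -/
theorem pb_card_filter_card_inter_eq_le {n k : ℕ} {A : Finset (Fin n)} (hA : #A = k) (i : ℕ) :
    #((powersetCard k (univ : Finset (Fin n))).filter fun B => #(A ∩ B) = i) ≤ k.choose i * n.choose (k - i) := by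
  -- adapted from Theorems/OneSliceSliceTargetCoincidenceTail2.lean (`card_filter_card_inter_eq_le`)
  calc #((powersetCard k (univ : Finset (Fin n))).filter fun B => #(A ∩ B) = i)
      ≤ #((powersetCard i A) ×ˢ (powersetCard (k - i) (univ : Finset (Fin n)))) := by
        refine card_le_card_of_injOn (fun B => (A ∩ B, B \ A)) (fun B hB => ?_) (fun B₁ _ B₂ _ h => ?_)
        · have hB' := hB
          simp only [mem_coe, mem_filter] at hB'
          obtain ⟨hB𝒜, hi⟩ := hB'
          have hBk : #B = k := (mem_powersetCard.1 hB𝒜).2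
          simp only [mem_coe, mem_product, mem_powersetCard]
          refine ⟨⟨inter_subset_left, hi⟩, subset_univ _, ?_⟩
          have := card_sdiff_add_card_inter B A
          rw [inter_comm] at hi
          omega
        · simp only [Prod.mk.injEq] at h
          ext v
          by_cases hv : v ∈ A
          · simpa [hv] using congrArg (v ∈ ·) h.1
          · simpa [hv] using congrArg (v ∈ ·) h.2
    _ = k.choose i * n.choose (k - i) := by
        rw [card_product, card_powersetCard, card_powersetCard, hA, card_univ, Fintype.card_fin]

end

end Summit.PneNP.PneNP.Cruxes.SliceTarget.Ideator3Line
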